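import Summits.BirchSwinnertonDyer.BirchSwinnertonDyer.Theorems.RamifiedHeegnerPairLeafRankZeroUpperAtThreeShimuraInertSupply
import Summits.BirchSwinnertonDyer.BirchSwinnertonDyer.Theorems.RamifiedHeegnerPairLeafRankZeroUpperAtThreeMonoCarrierAny
import HarnessLib

/-!
# Route `RamifiedHeegnerPair`, crux U₀ `LeafRankZeroUpperAtThree` (stmt-BirchSwinnertonDyer-26024), line `splitkolyvagin0` —
# the INERT-CARRIER (Shimura-curve) road for U₀, part 4: THE RE-THREADED COMPOSITION of skeleton v8 —
# `LeafRankZeroUpperAtThree` ⟸ PUB₀⁺ ∧ F1–F3 ∧ SHIMURA FACTS₀ ∧ Σ★⁵₀ ∧ L₁ ∧ L₀, with Σ★⁵₀ = Σ★‴ OFF the (nonempty) Shimura rows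

HONEST FRAMING. Theorems only; helper file (`--supports stmt-BirchSwinnertonDyer-26024 --as helper`); nothing is booked, no item is
closed, BSD is not proved for any curve; CONDITIONAL on every displayed input. Lead prover bsd-line-rhp-p2 g10, 2026-08-28.

* `sigmaStarOptOffShimuraRowsNe_of_sigmaStarOptOffMonoRows` — Σ★‴ ⟹ Σ★⁵₀ (one more negated row binder; 27493 ⟹ Σ★‴ ⟹ Σ★⁵₀).
* `leafRankZeroUpperAtThree_of_pubManin_of_namedFacts_of_shimuraFactsZero_of_sigmaStarOptOffShimuraRowsNe_of_lowerRankOne_of_lowerRankZero`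
  — THE v8 COMPOSITION for U₀: `PUB₀⁺ → F1 → F2 → F3 → JL → PastenCO → CST-JSW → FH-simple-zero-inert-split → Σ★⁵₀ → L₁ → L₀ →
  LeafRankZeroUpperAtThree` (conclusion literally the route decl). Proof: optimal member `W₀ ∼ W`; at `W₀`: nonempty Shimura row ⇒ part 3
  (`leafRankZeroUpper_three_of_shimuraInert_of_lowerRankOne`: named facts ∧ L₁ — NO Σ, NO L₀); else mono-carrier row ⇒ the any-carrier
  reading R|₂ (p645085's per-curve road, with L₁ and W₀'s own lower half from L₀); else Σ★⁵₀ at the datum; transport back (Cassels + GZK).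

THE (NONEMPTY) SHIMURA ROWS for U₀: SHAPE «`3 ∣ c_q ⇒ q` split multiplicative» ∧ `∃ S` NONEMPTY even set of multiplicative primes holding
every split-multiplicative carrier with (DEG)-availability (Pasten 6.15 | 6.16 | 6.18) — `S ≠ ∅` because the Friedberg–Hoffstein simple-zero
supply is typed for a nonempty inert set (`S = ∅` rows are Tamagawa-free or mono-carrier anyway). Census (rank-zero Gss2, `N < 5·10⁵`): 103
multi-carrier classes; 51 are Shimura rows (59 with the `q = 2` cokernel clause). BSD is not proved; U₀ / L₁ / L₀ / Σ★⁵₀ OPEN.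
References: [cite: JetchevSkinnerWan2017, §7.4.1–7.4.2, Thm. 4.4.1] [cite: CaiShuTian2014, Thm. 1.5] [cite: PastenShimura2024, §6]
[cite: FriedbergHoffstein1995, Thm. B] [cite: BumpFriedbergHoffstein1990, Theorem (pp. 543–544)] [cite: Jetchev2008, Conj. 1.3, Thm. 1.4]
[cite: MatarNekovar2019, Thm. 0.7] [cite: Mazur1978, Cor. 4.1] [cite: MilneADT2006, Thm. I.7.3] [cite: Miller2011LMS, Def. 1.1].
-/

-- D-0017: single-problem summit, so `Summit.BirchSwinnertonDyer.BirchSwinnertonDyer.…` repeats a namespace BY DESIGN.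
set_option linter.dupNamespace false
set_option autoImplicit false

noncomputable section

open scoped Classical NumberField

open WeierstrassCurve NumberField IsDedekindDomain Literature Literature.NumberTheory.EllipticCurves
  Rat.HeightOneSpectrum
  Literature.NumberTheory.EllipticCurves.ModularForms
  Literature.NumberTheory.EllipticCurves.Rank1Residual
  Literature.NumberTheory.EllipticCurves.Rank1Residual.Typed
  Literature.NumberTheory.QuadraticFields.Quadratic
  Literature.NumberTheory.Automorphic
  Summit.BirchSwinnertonDyer.Rank1Residual
  Summit.BirchSwinnertonDyer.Rank1Residual.Additive
  Summit.BirchSwinnertonDyer.Rank1Residual.X11b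
  Summit.BirchSwinnertonDyer.Rank1Residual.X11b.Three
  Summit.BirchSwinnertonDyer.BirchSwinnertonDyer.Theses.RamifiedHeegnerPair
  Summit.BirchSwinnertonDyer.BirchSwinnertonDyer.Theorems
  Summit.BirchSwinnertonDyer.BirchSwinnertonDyer.Theorems.RamifiedPairUpperBound

namespace Summit.BirchSwinnertonDyer.BirchSwinnertonDyer.Theorems.LeafShimuraInert

/-! ## §U0.5 Σ★‴ ⟹ Σ★⁵₀ and the composition of skeleton v8 (U₀) -/

/-- **Σ★‴ ⟹ Σ★⁵₀** (weakening: Σ★⁵₀ is Σ★‴'s text with ONE more negated row binder «not a NONEMPTY Shimura row» inserted after the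
mono-carrier negation). Hence item 27493 ⟹ Σ★‴ ⟹ Σ★⁵₀. [cite: Jetchev2008, Conj. 1.3 (p. 812)] -/
theorem sigmaStarOptOffShimuraRowsNe_of_sigmaStarOptOffMonoRows
    (hStar : ∀ (W : WeierstrassCurve ℚ) [W.IsElliptic] [W.IsGloballyMinimal] (N : ℕ) [NeZero N]
      (K : Type) [Field K] [NumberField K]
      (Dt : ModularParametrizationData W N) (H : HeegnerDatum N (NumberField.discr K)) (ι : K →+* ℂ)
      (P : (W.baseChange K).toAffine.Point),
      ¬ W.HasCM → Addv W 3 → SubGss W 3 → W.conductorNorm ℤ = N →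
      (∀ z ∈ Dt.L.lattice, ∃ w ∈ periodLattice Dt.f, z = Dt.c * w) →
      ¬ (∃ (q : ℕ) (_ : Fact q.Prime), q ∣ N ∧
          padicValNat 3 W.tamagawaProduct ≤ padicValNat 3 ((W.baseChange ℚ_[q]).localTamagawaNumber ℤ_[q])) →
      IsImaginaryQuadratic K → SatisfiesHeegnerHypothesis N K →
      (WeierstrassCurve.Affine.Point.map ι.toRatAlgHom) P = heegnerPointComplex Dt H →
      ¬ IsOfFinAddOrder P → Odd (NumberField.discr K) →
      ∀ (s' : ℕ), s' ≤ padicValNat 3 W.tamagawaProduct + padicValNat 3 Dt.c.natAbs →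
      ∀ (n : ℕ) (d : KolyvaginHeegnerData Dt H.β ι n), Squarefree n →
      (∀ ℓ ∈ n.primeFactors, Zhang2014.IsKolyvaginPrime N W K 3 ℓ ∧ s' ≤ Zhang2014.kolyvaginIndex W 3 ℓ) →
      Koly.PDiv d 3 s') :
    ∀ (W : WeierstrassCurve ℚ) [W.IsElliptic] [W.IsGloballyMinimal] (N : ℕ) [NeZero N]
      (K : Type) [Field K] [NumberField K]
      (Dt : ModularParametrizationData W N) (H : HeegnerDatum N (NumberField.discr K)) (ι : K →+* ℂ)
      (P : (W.baseChange K).toAffine.Point),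
      ¬ W.HasCM → Addv W 3 → SubGss W 3 → W.conductorNorm ℤ = N →
      (∀ z ∈ Dt.L.lattice, ∃ w ∈ periodLattice Dt.f, z = Dt.c * w) →
      ¬ (∃ (q : ℕ) (_ : Fact q.Prime), q ∣ N ∧
          padicValNat 3 W.tamagawaProduct ≤ padicValNat 3 ((W.baseChange ℚ_[q]).localTamagawaNumber ℤ_[q])) →
      ¬ ((∀ (q : ℕ) [Fact q.Prime], 3 ∣ (W.baseChange ℚ_[q]).localTamagawaNumber ℤ_[q] →
            W.HasSplitMultiplicativeReductionAtPrime q) ∧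
          ∃ S : Finset ℕ, S.Nonempty ∧ Even S.card ∧ (∀ ℓ ∈ S, ∃ _ : Fact ℓ.Prime, W.HasMultiplicativeReductionAtPrime ℓ) ∧
            (∀ (ℓ : ℕ) [Fact ℓ.Prime], ℓ ∉ S → W.HasSplitMultiplicativeReductionAtPrime ℓ →
              ¬ 3 ∣ padicValInt ℓ W.minimalDiscriminantInt) ∧
            ((∃ ℓ₀ ∈ S, ¬ 3 ∣ padicValInt ℓ₀ W.minimalDiscriminantInt) ∨
              (∃ ℓ₀ t : ℕ, ∃ _ : Fact ℓ₀.Prime, ∃ _ : Fact t.Prime,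
                W.HasMultiplicativeReductionAtPrime ℓ₀ ∧ W.HasMultiplicativeReductionAtPrime t ∧
                ℓ₀ ∉ S ∧ t ∉ S ∧ t ≠ ℓ₀ ∧ ¬ 3 ∣ padicValInt ℓ₀ W.minimalDiscriminantInt) ∨
              (∃ q₁ q₂ : ℕ, S = {q₁, q₂} ∧ q₁ ≠ q₂ ∧ q₂ ≠ 2 ∧ q₂ % 3 ≠ 1))) →
      IsImaginaryQuadratic K → SatisfiesHeegnerHypothesis N K →
      (WeierstrassCurve.Affine.Point.map ι.toRatAlgHom) P = heegnerPointComplex Dt H →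
      ¬ IsOfFinAddOrder P → Odd (NumberField.discr K) →
      ∀ (s' : ℕ), s' ≤ padicValNat 3 W.tamagawaProduct + padicValNat 3 Dt.c.natAbs →
      ∀ (n : ℕ) (d : KolyvaginHeegnerData Dt H.β ι n), Squarefree n →
      (∀ ℓ ∈ n.primeFactors, Zhang2014.IsKolyvaginPrime N W K 3 ℓ ∧ s' ≤ Zhang2014.kolyvaginIndex W 3 ℓ) →
      Koly.PDiv d 3 s' :=
  fun W _ _ N _ K _ _ Dt H ι P hCM hadd hsub hN hopt hrow _ hK hHN hP hnt hodd s' hs' n d hn hℓ ↦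
    hStar W N K Dt H ι P hCM hadd hsub hN hopt hrow hK hHN hP hnt hodd s' hs' n d hn hℓ

/-- **`LeafRankZeroUpperAtThree` ⟸ PUB₀⁺ ∧ F1–F3 ∧ SHIMURA FACTS₀ ∧ Σ★⁵₀ ∧ L₁ ∧ L₀ — the composition of skeleton v8 for U₀** (conclusion
literally the route decl). Hypotheses BY NAME: PUB₀⁺ (the registered twelve-fact print conjunction of `splitkolyvagin0`); F1–F3; the four
Shimura-road facts `nonempty_shimuraParametrizationData`, `PastenShimura2024_componentOrders`, `shimuraCurve_heegnerPoint_grossZagier_kolyvagin`,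
`friedbergHoffstein_exists_twist_simpleZero_inertAt_splitAt`; the research stub Σ★⁵₀; L₁ = item 26021; L₀ = item 26023 (only on the
non-Shimura rows, for the optimal member's own lower half in the `X₀(N)` roads). CONDITIONAL; U₀ stays OPEN; BSD is not proved.
[cite: JetchevSkinnerWan2017, §7.4.1–7.4.2, Thm. 4.4.1] [cite: CaiShuTian2014, Thm. 1.5] [cite: PastenShimura2024, Prop. 6.13, Lemmas 6.15–6.16, 6.18]
[cite: FriedbergHoffstein1995, Thm. B] [cite: Jetchev2008, Conj. 1.3, Thm. 1.4 (p. 812)] [cite: MatarNekovar2019, Thm. 0.7 (p. 456)]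
[cite: Mazur1978, Cor. 4.1] [cite: MilneADT2006, Thm. I.7.3] [cite: Miller2011LMS, Def. 1.1] -/
theorem leafRankZeroUpperAtThree_of_pubManin_of_namedFacts_of_shimuraFactsZero_of_sigmaStarOptOffShimuraRowsNe_of_lowerRankOne_of_lowerRankZero
    (hpub : ((∀ (N : ℕ) [NeZero N] (W : WeierstrassCurve ℚ) (K : Type) [Field K] [NumberField K],
        Literature.NumberTheory.EllipticCurves.gross_zagier N W K) ∧
      (∀ (N : ℕ) [NeZero N] (W : WeierstrassCurve ℚ) (K : Type) [Field K] [NumberField K],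
        Literature.NumberTheory.EllipticCurves.kolyvagin N W K) ∧
      Literature.NumberTheory.EllipticCurves.rank_eq_analyticRank_of_analyticRank_le_one ∧
      WeierstrassCurve.hasEntireLFunction_rat ∧
      Literature.NumberTheory.EllipticCurves.MatarNekovar2019.thm07_padicValNat_card_sha_primary_add_le_of_globalDivisibility_of_irreducible ∧
      Literature.NumberTheory.EllipticCurves.ModularForms.exists_isNewformOf ∧
      Literature.NumberTheory.EllipticCurves.bumpFriedbergHoffstein_exists_heegnerField_split_twist_simpleZero ∧
      Literature.NumberTheory.EllipticCurves.ModularForms.nonempty_modularParametrizationData ∧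
      WeierstrassCurve.bsdRHS_eq_of_isIsogenous ∧
      Literature.NumberTheory.EllipticCurves.ModularForms.mazur_not_dvd_maninConstant_of_odd ∧
      Literature.NumberTheory.EllipticCurves.ModularForms.abbesUllmo_not_dvd_maninConstant_of_not_dvd_level ∧
      Literature.NumberTheory.EllipticCurves.ModularForms.cesnavicius_not_two_dvd_maninConstant_of_two_dvd_level))
    (h37 : GrossLMS1991.prop37_2_frobeniusCongruence)
    (hPT : ∀ (K : Type) [Field K] [NumberField K],
      Literature.NumberTheory.GaloisCohomology.poitouTate_selmerStructure_duality_conj K)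
    (hF1 : Gross1991_heegnerPoint_sub_ratTorsion_mem_E0_imageFree)
    (hJL : nonempty_shimuraParametrizationData) (hCO : PastenShimura2024_componentOrders)
    (hHK : shimuraCurve_heegnerPoint_grossZagier_kolyvagin)
    (hFH1 : friedbergHoffstein_exists_twist_simpleZero_inertAt_splitAt)
    (hStar : ∀ (W : WeierstrassCurve ℚ) [W.IsElliptic] [W.IsGloballyMinimal] (N : ℕ) [NeZero N]
      (K : Type) [Field K] [NumberField K]
      (Dt : ModularParametrizationData W N) (H : HeegnerDatum N (NumberField.discr K)) (ι : K →+* ℂ)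
      (P : (W.baseChange K).toAffine.Point),
      ¬ W.HasCM → Addv W 3 → SubGss W 3 → W.conductorNorm ℤ = N →
      (∀ z ∈ Dt.L.lattice, ∃ w ∈ periodLattice Dt.f, z = Dt.c * w) →
      ¬ (∃ (q : ℕ) (_ : Fact q.Prime), q ∣ N ∧
          padicValNat 3 W.tamagawaProduct ≤ padicValNat 3 ((W.baseChange ℚ_[q]).localTamagawaNumber ℤ_[q])) →
      ¬ ((∀ (q : ℕ) [Fact q.Prime], 3 ∣ (W.baseChange ℚ_[q]).localTamagawaNumber ℤ_[q] →
            W.HasSplitMultiplicativeReductionAtPrime q) ∧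
          ∃ S : Finset ℕ, S.Nonempty ∧ Even S.card ∧ (∀ ℓ ∈ S, ∃ _ : Fact ℓ.Prime, W.HasMultiplicativeReductionAtPrime ℓ) ∧
            (∀ (ℓ : ℕ) [Fact ℓ.Prime], ℓ ∉ S → W.HasSplitMultiplicativeReductionAtPrime ℓ →
              ¬ 3 ∣ padicValInt ℓ W.minimalDiscriminantInt) ∧
            ((∃ ℓ₀ ∈ S, ¬ 3 ∣ padicValInt ℓ₀ W.minimalDiscriminantInt) ∨
              (∃ ℓ₀ t : ℕ, ∃ _ : Fact ℓ₀.Prime, ∃ _ : Fact t.Prime,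
                W.HasMultiplicativeReductionAtPrime ℓ₀ ∧ W.HasMultiplicativeReductionAtPrime t ∧
                ℓ₀ ∉ S ∧ t ∉ S ∧ t ≠ ℓ₀ ∧ ¬ 3 ∣ padicValInt ℓ₀ W.minimalDiscriminantInt) ∨
              (∃ q₁ q₂ : ℕ, S = {q₁, q₂} ∧ q₁ ≠ q₂ ∧ q₂ ≠ 2 ∧ q₂ % 3 ≠ 1))) →
      IsImaginaryQuadratic K → SatisfiesHeegnerHypothesis N K →
      (WeierstrassCurve.Affine.Point.map ι.toRatAlgHom) P = heegnerPointComplex Dt H →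
      ¬ IsOfFinAddOrder P → Odd (NumberField.discr K) →
      ∀ (s' : ℕ), s' ≤ padicValNat 3 W.tamagawaProduct + padicValNat 3 Dt.c.natAbs →
      ∀ (n : ℕ) (d : KolyvaginHeegnerData Dt H.β ι n), Squarefree n →
      (∀ ℓ ∈ n.primeFactors, Zhang2014.IsKolyvaginPrime N W K 3 ℓ ∧ s' ≤ Zhang2014.kolyvaginIndex W 3 ℓ) →
      Koly.PDiv d 3 s')
    (hL1 : Gss2LowerAtThreeRankOne) (hL0 : Gss2LowerAtThreeRankZero) :
    LeafRankZeroUpperAtThree := by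
  intro W _ _ hCM hadd hsub hr
  obtain ⟨hGZ, hKo, hGZK, hmod, hMN, hnf, hBFH, -, hCassels, hM, hAU, hC2⟩ := hpub
  haveI : Fact (Nat.Prime 3) := ⟨Nat.prime_three⟩
  have hR₂ := JetchevReadingAnyCarrier.anyCarrierTwoSplitReading_of_namedFacts h37 hPT hF1
  obtain ⟨W₀, hW₀, hW₀', N, hN0, D₀, hiso, hN₀, -, hopt, hCM₀, hadd₀, hsub₀, hr₀⟩ :=
    exists_optimal_leaf_member hnf W hCM hadd hsub
  haveI := hW₀
  haveI := hW₀'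
  haveI := hN0
  have hr₀' : W₀.analyticRank = 0 := hr₀.trans hr
  -- settle U₀ at the optimal member `W₀` by the three-way row split
  have h₀ : MissingUpperBoundAt W₀ 3 := by
    subst hN₀
    have hc : ¬ (3 : ℤ) ∣ D₀.c := not_three_dvd_c_of_latticeOptimal_of_subGss hM hAU hC2 hnf W₀ D₀ hopt hadd₀ hsub₀
    by_cases hSh : ((∀ (q : ℕ) [Fact q.Prime], 3 ∣ (W₀.baseChange ℚ_[q]).localTamagawaNumber ℤ_[q] →
            W₀.HasSplitMultiplicativeReductionAtPrime q) ∧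
          ∃ S : Finset ℕ, S.Nonempty ∧ Even S.card ∧ (∀ ℓ ∈ S, ∃ _ : Fact ℓ.Prime, W₀.HasMultiplicativeReductionAtPrime ℓ) ∧
            (∀ (ℓ : ℕ) [Fact ℓ.Prime], ℓ ∉ S → W₀.HasSplitMultiplicativeReductionAtPrime ℓ →
              ¬ 3 ∣ padicValInt ℓ W₀.minimalDiscriminantInt) ∧
            ((∃ ℓ₀ ∈ S, ¬ 3 ∣ padicValInt ℓ₀ W₀.minimalDiscriminantInt) ∨
              (∃ ℓ₀ t : ℕ, ∃ _ : Fact ℓ₀.Prime, ∃ _ : Fact t.Prime,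
                W₀.HasMultiplicativeReductionAtPrime ℓ₀ ∧ W₀.HasMultiplicativeReductionAtPrime t ∧
                ℓ₀ ∉ S ∧ t ∉ S ∧ t ≠ ℓ₀ ∧ ¬ 3 ∣ padicValInt ℓ₀ W₀.minimalDiscriminantInt) ∨
              (∃ q₁ q₂ : ℕ, S = {q₁, q₂} ∧ q₁ ≠ q₂ ∧ q₂ ≠ 2 ∧ q₂ % 3 ≠ 1)))
    · -- a nonempty Shimura row: the inert-carrier road (part 3), no Σ, no L₀
      obtain ⟨hshape, S, hSne, hSeven, hSmult, hFC, hDEG⟩ := hSh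
      exact leafRankZeroUpper_three_of_shimuraInert_of_lowerRankOne hGZK hmod hnf hJL hCO hHK hFH1 hL1 W₀ hCM₀ hadd₀ hsub₀
        hr₀' rfl D₀ hc S hSeven hSne hSmult hFC hshape hDEG
    · by_cases hrow : ∃ (q : ℕ) (_ : Fact q.Prime), q ∣ W₀.conductorNorm ℤ ∧
          padicValNat 3 W₀.tamagawaProduct ≤ padicValNat 3 ((W₀.baseChange ℚ_[q]).localTamagawaNumber ℤ_[q])
      · -- a mono-carrier row: the any-carrier reading from F1–F3 (with L₁ and `W₀`'s own lower half from L₀)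
        obtain ⟨q, _, hqN, hmono⟩ := hrow
        exact leafRankZeroUpper_three_monoCarrierAny_of_anyCarrierReading_of_lowerRankOne hGZ hKo hGZK hmod hMN hnf hBFH
          hR₂ hL1 W₀ hCM₀ hadd₀ hsub₀ hr₀' (hL0 W₀ hCM₀ hadd₀ hsub₀ hr₀') q hqN hmono D₀ hc
      · -- the research residue Σ★⁵₀ at the datum
        exact leafRankZeroUpper_three_of_sigmaAtDatum_of_lowerRankOne hGZ hKo hGZK hmod hMN hnf hBFH hL1 W₀ hCM₀ hadd₀ hsub₀
          hr₀' (hL0 W₀ hCM₀ hadd₀ hsub₀ hr₀') D₀ (fun K _ _ H ι P hK hHN _ _ hP hnt hodd s' hs' n d hn hℓ ↦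
            hStar W₀ (W₀.conductorNorm ℤ) K D₀ H ι P hCM₀ hadd₀ hsub₀ rfl hopt hrow hSh hK hHN hP hnt hodd s' hs' n d hn hℓ)
  -- and transport it back along `W ∼ W₀`
  exact missingUpperBoundAt_of_isIsogenous_of_analyticRank_le_one hCassels hGZK hmod (by rw [hr]; exact zero_le_one) hiso h₀

end Summit.BirchSwinnertonDyer.BirchSwinnertonDyer.Theorems.LeafShimuraInert

end
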